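import Mathlib

/-!
# Landau tail: the velocity gradient is super-self-similar in every core ball

Helper file for crux `LandauTailBlowup` (stmt-NavierStokesRegularity-1944), line `registered`,
registered stub `landauTail_core_gradient_unbounded` (C2, "the velocity gradient is
super-self-similar in every core ball").

Setting: a "Landau tail" of a blow-up at the space-time origin: the self-similarly rescaled
slices `√(-t) • u t (√(-t) • y)` converge pointwise on `y ≠ 0`, as `t → 0⁻`, to a nonzero
profile `U` which is homogeneous of degree `-1`.  Such a profile vanishes at `0` and is unbounded
along every ray where it is nonzero (`‖U (c • y)‖ = c⁻¹ * ‖U y‖`).  On the other hand a bound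
`(-t) * ‖fderiv ℝ (u t) x‖ ≤ M` on the whole core ball `ball 0 (ρ * √(-t))` says, by the chain
rule, that the rescaled slice has derivative of norm `≤ M` on `ball 0 ρ`, hence (mean value
inequality on the convex ball) is `M`-Lipschitz there.  If this happened for times `t` arbitrarily
close to `0⁻`, passing to the limit at two points `y₁` and `(n+1)⁻¹ • y₁` of one ray inside
`ball 0 ρ` would give `n * ‖U y₁‖ = ‖U ((n+1)⁻¹ • y₁) - U y₁‖ ≤ 2 * M * ρ` for every `n`, which
is absurd.  Hence in every core ball the gradient eventually exceeds `M / (-t)` for every `M`: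
the gradient blows up strictly faster than the self-similar (Type I) rate in every core ball.

Pure calculus, Mathlib only: `HasFDerivAt.comp`, `HasFDerivAt.const_smul`,
`Convex.norm_image_sub_le_of_norm_hasFDerivWithin_le`, `Filter.Tendsto.eventually_const_lt`,
`Ioo_mem_nhdsLT`.
-/

set_option linter.dupNamespace false

namespace Summit.NavierStokesRegularity.NavierStokesRegularity.Theorems

open Set Filter Topology Metric

/-- **The velocity gradient is super-self-similar in every core ball** (registered stub C2 of
crux `LandauTailBlowup`, stmt-NavierStokesRegularity-1944).  Let `u : ℝ → ℝ³ → ℝ³` be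
differentiable in space for `t ∈ (-1, 0)` and admit a Landau tail at the origin: for every
`y ≠ 0`, `√(-t) • u t (√(-t) • y) → U y` as `t → 0⁻`, where the profile `U` is `(-1)`-homogeneous
(`U (c • x) = c⁻¹ • U x` for `c > 0`) and not identically zero.  Then for every core radius
`ρ > 0` and every level `M`, for all `t < 0` close enough to `0` some point `x` of the core ball
`ball 0 (ρ * √(-t))` has `M < (-t) * ‖fderiv ℝ (u t) x‖`.  Proof: otherwise, along times
accumulating at `0⁻`, the rescaled slice `y ↦ √(-t) • u t (√(-t) • y)` has derivative
`(-t) • fderiv ℝ (u t) (√(-t) • y)` of norm `≤ M` on `ball 0 ρ` (chain rule), hence is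
`M`-Lipschitz there (`Convex.norm_image_sub_le_of_norm_hasFDerivWithin_le`); in the limit
`‖U y - U y₁‖ ≤ 2 * M * ρ` for `y, y₁ ∈ ball 0 ρ ∖ {0}`, contradicting
`‖U ((n+1)⁻¹ • y₁) - U y₁‖ = n * ‖U y₁‖ → ∞` on a ray where `U y₁ ≠ 0`. -/
theorem landauTail_core_gradient_unbounded : ∀ (u : ℝ → EuclideanSpace ℝ (Fin 3) → EuclideanSpace ℝ (Fin 3)) (U : EuclideanSpace ℝ (Fin 3) → EuclideanSpace ℝ (Fin 3)), (∀ c : ℝ, 0 < c → ∀ x : EuclideanSpace ℝ (Fin 3), U (c • x) = c⁻¹ • U x) → (∃ x : EuclideanSpace ℝ (Fin 3), U x ≠ 0) → (∀ t ∈ Set.Ioo (-1 : ℝ) 0, Differentiable ℝ (u t)) → (∀ y : EuclideanSpace ℝ (Fin 3), y ≠ 0 → Filter.Tendsto (fun t : ℝ => Real.sqrt (0 - t) • u t (Real.sqrt (0 - t) • y)) (nhdsWithin 0 (Set.Iio 0)) (nhds (U y))) → ∀ ρ : ℝ, 0 < ρ → ∀ M : ℝ, ∀ᶠ t in nhdsWithin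 (0 : ℝ) (Set.Iio 0), ∃ x ∈ Metric.ball (0 : EuclideanSpace ℝ (Fin 3)) (ρ * Real.sqrt (-t)), M < (-t) * ‖fderiv ℝ (u t) x‖ := by
  intro u U hU hne hdiff htail ρ hρ
  -- Step 0: it suffices to treat levels `0 ≤ M` (apply that case to `|M| ≥ M`).
  suffices key : ∀ M : ℝ, 0 ≤ M → ∀ᶠ t in 𝓝[<] (0 : ℝ),
      ∃ x ∈ ball (0 : EuclideanSpace ℝ (Fin 3)) (ρ * Real.sqrt (-t)),
        M < (-t) * ‖fderiv ℝ (u t) x‖ by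
    intro M
    exact (key |M| (abs_nonneg M)).mono fun t ⟨x, hx, h⟩ => ⟨x, hx, (le_abs_self M).trans_lt h⟩
  intro M hM
  -- Step 1: `U 0 = 0` (homogeneity at `x = 0`), so a point where `U ≠ 0` is itself nonzero.
  have hU0 : U 0 = 0 := by
    have h := hU 2 two_pos 0
    rw [smul_zero] at h
    have h' : (1 - (2 : ℝ)⁻¹) • U 0 = 0 := by rw [sub_smul, one_smul, ← h, sub_self]
    exact (smul_eq_zero.mp h').resolve_left (by norm_num)
  obtain ⟨x₀, hx₀⟩ := hne
  have hx₀ne : x₀ ≠ 0 := fun h => hx₀ (by rw [h, hU0])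
  have hx₀pos : 0 < ‖x₀‖ := norm_pos_iff.mpr hx₀ne
  -- Step 2: a base point `y₁` on the ray of `x₀` with `‖y₁‖ = ρ / 2`; there `U y₁ ≠ 0`.
  have hcoef : 0 < ρ / (2 * ‖x₀‖) := div_pos hρ (mul_pos two_pos hx₀pos)
  set y₁ : EuclideanSpace ℝ (Fin 3) := (ρ / (2 * ‖x₀‖)) • x₀ with hy₁def
  have hy₁norm : ‖y₁‖ = ρ / 2 := by
    rw [hy₁def, norm_smul_of_nonneg hcoef.le]
    field_simp
  have hy₁ne : y₁ ≠ 0 := smul_ne_zero hcoef.ne' hx₀ne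
  have hy₁ball : y₁ ∈ ball (0 : EuclideanSpace ℝ (Fin 3)) ρ := by
    rw [mem_ball_zero_iff, hy₁norm]; linarith
  have hUy₁ : U y₁ ≠ 0 := by
    rw [hy₁def, hU _ hcoef]
    exact smul_ne_zero (inv_ne_zero hcoef.ne') hx₀
  have hA : 0 < ‖U y₁‖ := norm_pos_iff.mpr hUy₁
  -- Step 3: a second point `y = (n+1)⁻¹ • y₁` on the same ray, so deep in the core that
  -- `‖U y - U y₁‖ = n * ‖U y₁‖ > 2 * M * ρ`.
  obtain ⟨n, hn⟩ := exists_nat_gt (2 * M * ρ / ‖U y₁‖)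
  have hn' : 2 * M * ρ < n * ‖U y₁‖ := (div_lt_iff₀ hA).mp hn
  have hn1 : (0 : ℝ) < n + 1 := by positivity
  set y : EuclideanSpace ℝ (Fin 3) := ((n : ℝ) + 1)⁻¹ • y₁ with hydef
  have hyne : y ≠ 0 := smul_ne_zero (inv_ne_zero hn1.ne') hy₁ne
  have hynorm : ‖y‖ ≤ ‖y₁‖ := by
    rw [hydef, norm_smul_of_nonneg (inv_nonneg.mpr hn1.le)]
    exact mul_le_of_le_one_left (norm_nonneg _) (inv_le_one_of_one_le₀ (by linarith))
  have hyball : y ∈ ball (0 : EuclideanSpace ℝ (Fin 3)) ρ := by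
    rw [mem_ball_zero_iff]
    exact hynorm.trans_lt (mem_ball_zero_iff.mp hy₁ball)
  have hUy : U y - U y₁ = (n : ℝ) • U y₁ := by
    rw [hydef, hU _ (inv_pos.mpr hn1), inv_inv, add_smul, one_smul, add_sub_cancel_right]
  have hUnorm : ‖U y - U y₁‖ = n * ‖U y₁‖ := by
    rw [hUy, norm_smul_of_nonneg n.cast_nonneg]
  -- Step 4: as `t → 0⁻` the difference of the rescaled slices at `y` and `y₁` tends to
  -- `U y - U y₁`, so its norm eventually exceeds `2 * M * ρ`; also eventually `t ∈ (-1, 0)`.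
  have hlim : Tendsto (fun t : ℝ => ‖Real.sqrt (0 - t) • u t (Real.sqrt (0 - t) • y) -
      Real.sqrt (0 - t) • u t (Real.sqrt (0 - t) • y₁)‖) (𝓝[<] 0) (𝓝 ‖U y - U y₁‖) :=
    ((htail y hyne).sub (htail y₁ hy₁ne)).norm
  have hev := hlim.eventually_const_lt (show 2 * M * ρ < ‖U y - U y₁‖ by rw [hUnorm]; exact hn')
  filter_upwards [hev, Ioo_mem_nhdsLT (show (-1 : ℝ) < 0 by norm_num)] with t ht₁ ht₂
  simp only [zero_sub] at ht₁
  -- Step 5: at such a time `t`, were the gradient bound to hold on the whole core ball, the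
  -- rescaled slice would be `M`-Lipschitz on `ball 0 ρ` (chain rule and the mean value
  -- inequality), contradicting Step 4.
  by_contra H
  push Not at H
  have ht0 : 0 < -t := by linarith [ht₂.2]
  set s : ℝ := Real.sqrt (-t) with hsdef
  have hs : 0 < s := Real.sqrt_pos.mpr ht0
  have hs2 : s * s = -t := Real.mul_self_sqrt ht0.le
  have hg : Differentiable ℝ (u t) := hdiff t ht₂
  have hderiv : ∀ z ∈ ball (0 : EuclideanSpace ℝ (Fin 3)) ρ,
      HasFDerivWithinAt (fun w : EuclideanSpace ℝ (Fin 3) => s • u t (s • w))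
        (s • ((fderiv ℝ (u t) (s • z)).comp
          (s • ContinuousLinearMap.id ℝ (EuclideanSpace ℝ (Fin 3)))))
        (ball (0 : EuclideanSpace ℝ (Fin 3)) ρ) z := by
    intro z _
    have h1 : HasFDerivAt (fun w : EuclideanSpace ℝ (Fin 3) => s • w)
        (s • ContinuousLinearMap.id ℝ (EuclideanSpace ℝ (Fin 3))) z :=
      (hasFDerivAt_id z).const_smul s
    have h2 : HasFDerivAt (u t) (fderiv ℝ (u t) (s • z)) (s • z) := (hg (s • z)).hasFDerivAt
    exact ((h2.comp z h1).const_smul s).hasFDerivWithinAt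
  have hbound : ∀ z ∈ ball (0 : EuclideanSpace ℝ (Fin 3)) ρ,
      ‖s • ((fderiv ℝ (u t) (s • z)).comp
          (s • ContinuousLinearMap.id ℝ (EuclideanSpace ℝ (Fin 3))))‖ ≤ M := by
    intro z hz
    rw [ContinuousLinearMap.comp_smul, ContinuousLinearMap.comp_id, norm_smul, norm_smul,
      Real.norm_of_nonneg hs.le, ← mul_assoc, hs2]
    refine H (s • z) ?_
    rw [mem_ball_zero_iff, norm_smul_of_nonneg hs.le, mul_comm ρ s]
    exact mul_lt_mul_of_pos_left (mem_ball_zero_iff.mp hz) hs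
  have hMVT : ‖s • u t (s • y) - s • u t (s • y₁)‖ ≤ M * ‖y - y₁‖ :=
    Convex.norm_image_sub_le_of_norm_hasFDerivWithin_le
      (f := fun w : EuclideanSpace ℝ (Fin 3) => s • u t (s • w)) hderiv hbound
      (convex_ball 0 ρ) hy₁ball hyball
  have hdist : ‖y - y₁‖ ≤ 2 * ρ :=
    (norm_sub_le y y₁).trans
      (by linarith [mem_ball_zero_iff.mp hyball, mem_ball_zero_iff.mp hy₁ball])
  have hM2 : M * ‖y - y₁‖ ≤ M * (2 * ρ) := mul_le_mul_of_nonneg_left hdist hM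
  have hfin : 2 * M * ρ < M * (2 * ρ) := ht₁.trans_le (hMVT.trans hM2)
  linarith

end Summit.NavierStokesRegularity.NavierStokesRegularity.Theorems
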